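import Summits.FinalStateConjecture.FinalStateConjecture.Theses.ProbeNullTrace

/-!
# Route ProbeNullTrace — support `SegmentToCurve` (stmt-FinalStateConjecture-9965), proved

Reparametrisation glue of the route (the curve form of Christodoulou's codimension-`≥ 1`
genericity, Christodoulou, CQG 16 (1999) A23, p. A24): if `Φ : ℝᵏ → InitialDataSet (𝓡 3) X` is a
jointly smooth injective `k`-parameter family of data in `𝓓` and the punctured segment
`{Φ (t • θ) : 0 < |t| < ε}` (`θ ≠ 0`) avoids `𝓔`, then
`F c := Φ ((ε · arctan (c 0) / 2) • θ)` is a jointly smooth injective one-parameter family in `𝓓`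
with `F 0 = Φ 0` meeting `𝓔` at most at `c = 0`.

* `ProbeNullTrace.isSmoothDataFamily_precomp` — `IsSmoothDataFamily` is stable under
  precomposition with a smooth map of parameter spaces (compose the two `ContMDiff` clauses with
  `(c, x) ↦ (σ c, x)`);
* `ProbeNullTrace.arctan_squash_spec` — the squashing map `σ(c) = (ε · arctan (c 0) / 2) • θ`,
  `ℝ¹ → ℝᵏ`: smooth, injective for `θ ≠ 0`, `σ 0 = 0`, and its parameter `ε · arctan (c 0) / 2` is
  non-zero for `c ≠ 0` and of modulus `< ε`;
* `segmentToCurve_proof` — literally the route decl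
  `Summit.FinalStateConjecture.FinalStateConjecture.Theses.ProbeNullTrace.SegmentToCurve`.

No definition is introduced; nothing is restated as a fact.
-/

noncomputable section

-- the summit-side namespace `Summit.FinalStateConjecture.FinalStateConjecture.…` is mandated (D-0022)
set_option linter.dupNamespace false

open Manifold Bundle Set
open scoped ContDiff Topology

namespace Summit.FinalStateConjecture.FinalStateConjecture.Theorems

open Literature.Geometry.Lorentzian

namespace ProbeNullTrace

section Families

variable {E : Type*} [NormedAddCommGroup E] [NormedSpace ℝ E] {H : Type*} [TopologicalSpace H]
  {I : ModelWithCorners ℝ E H} {X : Type*} [TopologicalSpace X] [ChartedSpace H X]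
  [IsManifold I ∞ X]

/-- **Precomposition with a smooth map of parameter spaces preserves joint smoothness** of a family
of initial data sets: `IsSmoothDataFamily` is smoothness of `(c, x) ↦ h_c(x)` and `(c, x) ↦ k_c(x)`
on `ℝᵐ × X`; compose both with the smooth map `(c', x) ↦ (σ c', x)`. -/
theorem isSmoothDataFamily_precomp {m m' : ℕ} {F : EuclideanSpace ℝ (Fin m) → InitialDataSet I X}
    (hF : InitialDataSet.IsSmoothDataFamily m F)
    {σ : EuclideanSpace ℝ (Fin m') → EuclideanSpace ℝ (Fin m)} (hσ : ContDiff ℝ ∞ σ) :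
    InitialDataSet.IsSmoothDataFamily m' (F ∘ σ) := by
  have hπ : ContMDiff ((𝓘(ℝ, EuclideanSpace ℝ (Fin m'))).prod I)
      ((𝓘(ℝ, EuclideanSpace ℝ (Fin m))).prod I) ∞
      (fun p : EuclideanSpace ℝ (Fin m') × X ↦ (σ p.1, p.2)) :=
    (hσ.contMDiff.comp contMDiff_fst).prodMk contMDiff_snd
  exact ⟨hF.1.comp hπ, hF.2.comp hπ⟩

end Families

/-- **The arctan squash of `ℝ¹` onto a punctured segment.** For `ε > 0` and `θ ≠ 0` in `ℝᵏ`, the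
map `σ(c) = (ε · arctan (c 0) / 2) • θ` is smooth and injective, `σ 0 = 0`, and for every `c` its
parameter `t = ε · arctan (c 0) / 2` satisfies `|t| < ε` (as `|arctan| < π / 2 ≤ 2`), with `t ≠ 0`
when `c ≠ 0`. -/
theorem arctan_squash_spec {k : ℕ} {θ : EuclideanSpace ℝ (Fin k)} (hθ : θ ≠ 0) {ε : ℝ}
    (hε : 0 < ε) :
    ContDiff ℝ ∞ (fun c : EuclideanSpace ℝ (Fin 1) ↦ (ε * Real.arctan (c 0) / 2) • θ) ∧
      Function.Injective (fun c : EuclideanSpace ℝ (Fin 1) ↦ (ε * Real.arctan (c 0) / 2) • θ) ∧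
      (ε * Real.arctan ((0 : EuclideanSpace ℝ (Fin 1)) 0) / 2) • θ = 0 ∧
      (∀ c : EuclideanSpace ℝ (Fin 1), |ε * Real.arctan (c 0) / 2| < ε) ∧
      ∀ c : EuclideanSpace ℝ (Fin 1), c ≠ 0 → ε * Real.arctan (c 0) / 2 ≠ 0 := by
  have hcoord : ∀ c c' : EuclideanSpace ℝ (Fin 1), c 0 = c' 0 → c = c' := by
    intro c c' h
    ext i
    fin_cases i
    exact h
  refine ⟨?_, ?_, ?_, ?_, ?_⟩
  · exact ((contDiff_const.mul (Real.contDiff_arctan.comp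
      (EuclideanSpace.proj (𝕜 := ℝ) (ι := Fin 1) 0).contDiff)).div_const _).smul contDiff_const
  · intro c c' h
    have h1 : ε * Real.arctan (c 0) / 2 = ε * Real.arctan (c' 0) / 2 := smul_left_injective ℝ hθ h
    have h2 : Real.arctan (c 0) = Real.arctan (c' 0) := by
      have h3 : ε * Real.arctan (c 0) = ε * Real.arctan (c' 0) := by linarith
      exact mul_left_cancel₀ hε.ne' h3
    exact hcoord c c' (Real.arctan_injective h2)
  · simp
  · intro c
    have hlt : |Real.arctan (c 0)| < 2 := by
      rw [abs_lt]
      constructor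
      · linarith [Real.neg_pi_div_two_lt_arctan (c 0), Real.pi_le_four]
      · linarith [Real.arctan_lt_pi_div_two (c 0), Real.pi_le_four]
    rw [abs_div, abs_mul, abs_of_pos hε, abs_two]
    nlinarith [abs_nonneg (Real.arctan (c 0))]
  · intro c hc h
    apply hc
    apply hcoord c 0
    have h4 : Real.arctan (c 0) = 0 := by
      have h5 : ε * Real.arctan (c 0) = 0 := by linarith
      exact (mul_eq_zero.mp h5).resolve_left hε.ne'
    simpa using Real.arctan_injective (h4.trans Real.arctan_zero.symm)

end ProbeNullTrace

/-- **Route decl `SegmentToCurve` (stmt-FinalStateConjecture-9965), proved.** If `Φ` is a jointly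
smooth injective `k`-parameter family of data in `𝓓` and the punctured segment
`{Φ (t • θ) : 0 < |t| < ε}` (`θ ≠ 0`, `ε > 0`) avoids `𝓔`, then `F := Φ ∘ σ` with the arctan squash
`σ(c) = (ε · arctan (c 0) / 2) • θ` of `ProbeNullTrace.arctan_squash_spec` is a jointly smooth
(`ProbeNullTrace.isSmoothDataFamily_precomp`) injective one-parameter family in `𝓓` with
`F 0 = Φ 0` and `F c ∉ 𝓔` for `c ≠ 0` — the witness `HasCodimAtLeastIn 𝓓 𝓔 1` asks for at `Φ 0`. -/
theorem segmentToCurve_proof :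
    Summit.FinalStateConjecture.FinalStateConjecture.Theses.ProbeNullTrace.SegmentToCurve := by
  unfold Summit.FinalStateConjecture.FinalStateConjecture.Theses.ProbeNullTrace.SegmentToCurve
  intro X _ _ _ 𝓓 𝓔 k Φ θ ε hΦ hinj h𝓓 hθ hε hseg
  obtain ⟨hσs, hσi, hσ0, hσlt, hσne⟩ := ProbeNullTrace.arctan_squash_spec hθ hε
  refine ⟨Φ ∘ fun c : EuclideanSpace ℝ (Fin 1) ↦ (ε * Real.arctan (c 0) / 2) • θ,
    ProbeNullTrace.isSmoothDataFamily_precomp hΦ hσs, ?_, hinj.comp hσi, fun c ↦ h𝓓 _, ?_⟩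
  · show Φ ((ε * Real.arctan ((0 : EuclideanSpace ℝ (Fin 1)) 0) / 2) • θ) = Φ 0
    rw [hσ0]
  · intro c hc
    exact hseg _ (hσne c hc) (hσlt c)

end Summit.FinalStateConjecture.FinalStateConjecture.Theorems

end
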